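import Literature.Probability.ODonnellSaksSchrammServedio2005.BiasedCube
import HarnessLib

/-!
# The biased cube over a disjoint union of coordinates: Fubini, marginals, and the no-success product formula

Support file (companion of `BiasedCube.lean`) for Hutchcroft's volume differential inequality, where the
product space is `{0,1}^{E ⊔ V}` — edge coordinates and an independent "ghost field" on the vertices
[Hutchcroft 2020, §3: "Independently of `ω`, let `η ∈ {0,1}^V` be a random subset of `V` where vertices
are included independently at random with inclusion probability `h`"].  Proved (finite sums, [folklore]
probability on product spaces, cited to the place where the source uses them):

* `wt_sumElim`, `sum_cube_sumType`, `sum_wt_sumElim`, `sum_wt_sumElim_left` — the product weight on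
  `α ⊕ β → Bool` factorises and sums split (independence of `ω` and `η`; Fubini);
* `sum_wt_forall_false` — `P(no coordinate of K is true) = ∏_{u ∈ K} (1 − q_u)`, and
  `sum_wt_exists_true` — `P(some coordinate of K is true) = 1 − ∏_{u ∈ K} (1 − q_u)`
  (Hutchcroft: `P(η(K) ≥ 1 | ω) = 1 − e^{−λ|K|/n}` with `h = 1 − e^{−λ/n}`).
-/

namespace Literature.Probability.ODonnellSaksSchrammServedio2005

open Finset Function

variable {α β : Type*} [Fintype α] [Fintype β] [DecidableEq α] [DecidableEq β]

omit [DecidableEq α] [DecidableEq β] in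
/-- The product weight on `α ⊕ β → Bool` factorises into the two marginal weights (independence of the
two blocks of coordinates). [cite: Hutchcroft2020, §3 proof of Prop 3.1 (η independent of ω)] -/
theorem wt_sumElim (pa : α → ℝ) (pb : β → ℝ) (x : α ⊕ β → Bool) :
    wt (Sum.elim pa pb) x = wt pa (fun a => x (Sum.inl a)) * wt pb (fun b => x (Sum.inr b)) := by
  unfold wt
  rw [Fintype.prod_sum_type]
  simp [coordWt]

/-- Fubini for the cube over a disjoint union: `∑_{x} F x = ∑_y ∑_z F (y ⊔ z)`.
[cite: Hutchcroft2020, §3 proof of Prop 3.1 (joint law of ω and η)] -/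
theorem sum_cube_sumType (F : (α ⊕ β → Bool) → ℝ) :
    ∑ x : α ⊕ β → Bool, F x = ∑ y : α → Bool, ∑ z : β → Bool, F (Sum.elim y z) := by
  rw [← Fintype.sum_prod_type']
  refine Fintype.sum_equiv (Equiv.sumArrowEquivProdArrow α β Bool) _ _ (fun x => ?_)
  congr 1
  ext i
  cases i <;> simp [Equiv.sumArrowEquivProdArrow]

/-- Fubini with the weights: `E[F(x_α, x_β)] = ∑_y w_α(y) ∑_z w_β(z) F(y,z)`.
[cite: Hutchcroft2020, §3 proof of Prop 3.1 (joint law of ω and η)] -/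
theorem sum_wt_sumElim (pa : α → ℝ) (pb : β → ℝ) (F : (α → Bool) → (β → Bool) → ℝ) :
    ∑ x : α ⊕ β → Bool, wt (Sum.elim pa pb) x * F (fun a => x (Sum.inl a)) (fun b => x (Sum.inr b))
      = ∑ y : α → Bool, wt pa y * ∑ z : β → Bool, wt pb z * F y z := by
  rw [sum_cube_sumType]
  refine Finset.sum_congr rfl fun y _ => ?_
  rw [Finset.mul_sum]
  refine Finset.sum_congr rfl fun z _ => ?_
  rw [wt_sumElim]
  simp only [Sum.elim_inl, Sum.elim_inr]
  ring

/-- Marginalisation: a function of the `α`-block integrates against the `α`-marginal.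
[cite: Hutchcroft2020, §3 proof of Prop 3.1 (f independent of η)] -/
theorem sum_wt_sumElim_left (pa : α → ℝ) (pb : β → ℝ) (F : (α → Bool) → ℝ) :
    ∑ x : α ⊕ β → Bool, wt (Sum.elim pa pb) x * F (fun a => x (Sum.inl a))
      = ∑ y : α → Bool, wt pa y * F y := by
  have h := sum_wt_sumElim pa pb (fun y _ => F y)
  rw [h]
  refine Finset.sum_congr rfl fun y _ => ?_
  rw [← Finset.sum_mul, sum_wt, one_mul]

/-- THE NO-SUCCESS PRODUCT FORMULA: under the product law with biases `q`, the probability that no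
coordinate of the finite set `K` is `true` is `∏_{u ∈ K} (1 − q_u)`.
[cite: Hutchcroft2020, §3 proof of Prop 3.1 (P(η(K_u) ≥ 1) = μ[1 − e^{−λ|K_u|/n}])] -/
theorem sum_wt_forall_false (q : β → ℝ) (K : Finset β) :
    ∑ z : β → Bool, wt q z * (if ∀ u ∈ K, z u = false then (1 : ℝ) else 0) = ∏ u ∈ K, (1 - q u) := by
  classical
  -- the indicator is a product of one-coordinate factors
  have hind : ∀ z : β → Bool, (if ∀ u ∈ K, z u = false then (1 : ℝ) else 0)
      = ∏ u, (if u ∈ K ∧ z u = true then (0 : ℝ) else 1) := by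
    intro z
    by_cases h : ∀ u ∈ K, z u = false
    · rw [if_pos h]
      refine (Finset.prod_eq_one fun u _ => ?_).symm
      by_cases hu : u ∈ K
      · simp [hu, h u hu]
      · simp [hu]
    · rw [if_neg h]
      push Not at h
      obtain ⟨u, huK, hzu⟩ := h
      refine (Finset.prod_eq_zero (Finset.mem_univ u) ?_).symm
      simp [huK, hzu]
  simp_rw [hind]
  unfold wt
  simp_rw [← Finset.prod_mul_distrib]
  rw [← Fintype.prod_sum fun u b => coordWt q u b * (if u ∈ K ∧ b = true then (0 : ℝ) else 1)]
  rw [← Finset.prod_filter_mul_prod_filter_not Finset.univ (fun u => u ∈ K)]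
  have h1 : ∏ u ∈ Finset.univ.filter (fun u => u ∈ K),
      ∑ b : Bool, coordWt q u b * (if u ∈ K ∧ b = true then (0 : ℝ) else 1) = ∏ u ∈ K, (1 - q u) := by
    have hK : Finset.univ.filter (fun u => u ∈ K) = K := by ext u; simp
    rw [hK]
    refine Finset.prod_congr rfl fun u hu => ?_
    simp [coordWt, hu]
  have h2 : ∏ u ∈ Finset.univ.filter (fun u => ¬ u ∈ K),
      ∑ b : Bool, coordWt q u b * (if u ∈ K ∧ b = true then (0 : ℝ) else 1) = 1 := by
    refine Finset.prod_eq_one fun u hu => ?_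
    simp only [Finset.mem_filter, Finset.mem_univ, true_and] at hu
    simp [coordWt, hu]
  rw [h1, h2, mul_one]

/-- `P(some coordinate of K is true) = 1 − ∏_{u ∈ K} (1 − q_u)` under the product law with biases `q`.
[cite: Hutchcroft2020, §3 proof of Prop 3.1 (P(η(K_u) ≥ 1) = μ[1 − e^{−λ|K_u|/n}])] -/
theorem sum_wt_exists_true (q : β → ℝ) (K : Finset β) :
    ∑ z : β → Bool, wt q z * (if ∃ u ∈ K, z u = true then (1 : ℝ) else 0)
      = 1 - ∏ u ∈ K, (1 - q u) := by
  classical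
  have hpt : ∀ z : β → Bool, (if ∃ u ∈ K, z u = true then (1 : ℝ) else 0)
      + (if ∀ u ∈ K, z u = false then (1 : ℝ) else 0) = 1 := by
    intro z
    by_cases h : ∃ u ∈ K, z u = true
    · rw [if_pos h, if_neg]
      · ring
      · intro hall; obtain ⟨u, hu, hz⟩ := h; simp [hall u hu] at hz
    · rw [if_neg h, if_pos]
      · ring
      · intro u hu
        by_contra hz
        exact h ⟨u, hu, by simpa using hz⟩
  have hsum : (∑ z : β → Bool, wt q z * (if ∃ u ∈ K, z u = true then (1 : ℝ) else 0))
      + ∑ z : β → Bool, wt q z * (if ∀ u ∈ K, z u = false then (1 : ℝ) else 0) = 1 := by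
    rw [← Finset.sum_add_distrib]
    calc ∑ z : β → Bool, (wt q z * (if ∃ u ∈ K, z u = true then (1 : ℝ) else 0)
          + wt q z * (if ∀ u ∈ K, z u = false then (1 : ℝ) else 0))
        = ∑ z : β → Bool, wt q z := Finset.sum_congr rfl fun z _ => by rw [← mul_add, hpt z, mul_one]
      _ = 1 := sum_wt q
  rw [sum_wt_forall_false] at hsum
  linarith

end Literature.Probability.ODonnellSaksSchrammServedio2005
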